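import Summits.NavierStokesRegularity.NavierStokesRegularity.Theorems.TypeIIInviscidRelaxationAxisymSwirlRegularHalfLineBarrierCriterion
import Summits.NavierStokesRegularity.NavierStokesRegularity.Theorems.HodographBetchovFastClassSqueezeOfBounded
import Literature.Analysis.FluidPDE.ZhangPartialTypeI
import Literature.Analysis.FluidPDE.LerayHopfProofs
import HarnessLib

/-!
# Q. S. Zhang's partial Type I theorem BY NAME, modulo its one-dimensional barrier

Helper toward the crux `AxisymSwirlRegular` (stmt-NavierStokesRegularity-1964, route TypeIIInviscidRelaxation),
registered line `radial_inflow_split`, criterion side `stub_oneSidedRadialCriterion` (⟨19059⟩).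

The named Literature fact `Zhang2026_partialTypeI_regularity` (arXiv:2604.07785 Thm 1.1, UNPROVED in the tree:
an axisymmetric classical Leray–Hopf solution on `[0,T)` from a rapidly decaying datum with
`u_r ≥ −c/√(T−t)` everywhere is bounded on `[0,T) × ℝ³`) is REDUCED IN KERNEL to one statement of real analysis
on `(0,2) × (0,T)`: the existence, for every `c, T > 0`, of a time-dependent half-line barrier for the envelope
`E(r,t) = c/√(T−t)` (`zhang2026_partialTypeI_of_barrier`).  The PDE half of Zhang's proof (§3: swirl comparison,
Hölder modulus at the axis, continuation by the `Γ`-modulus criteria) is the tree theorem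
`RadialInflowComparisonT.hasSmoothExtensionPast_of_timeDependentBarrier`; the boundedness conclusion comes from
`FastClassSqueeze.bounded_of_hasSmoothExtensionPast`; the standing-class hypothesis «bounded on closed sub-slabs»
is DISCHARGED for classical Leray–Hopf solutions from rapidly decaying data (`exists_bound_subslab`, also useful for
the registered stubs of line `radial_inflow_split`, whose class carries that hypothesis explicitly).

What remains for `Zhang2026_partialTypeI_regularity_holds`: Zhang's §2 (Thm 2.1, the comparison function on the
half line for the drift `c(T−t)^{−1/2}∂_r`) as a `C²` barrier with the clauses below — the `κ = 1` member of the
κ-inflow family (`hasSmoothExtensionPast_of_kappaEnvelope`).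

References: Qi S. Zhang, arXiv:2604.07785 (2026), Thm 1.1, §2, §3 [Zhang2026PartialTypeI]; T. Tao, *Localisation
and compactness properties of the Navier–Stokes global regularity problem*, Anal. PDE 6 (2013), Cor. 11.1 [Tao2011].
-/

noncomputable section

set_option linter.dupNamespace false

open Literature.Analysis.FluidPDE MeasureTheory Set Filter Topology
open scoped ENNReal NNReal RealInnerProductSpace

namespace Summit.NavierStokesRegularity.NavierStokesRegularity.Theorems.RadialInflowComparisonT

open Summit.NavierStokesRegularity.NavierStokesRegularity.Theorems
open Summit.NavierStokesRegularity.NavierStokesRegularity.Theorems.ScenarioCensus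
open Summit.NavierStokesRegularity.NavierStokesRegularity.Theorems.ScenarioCensus.LogGate

/-- **Classical Leray–Hopf solutions from rapidly decaying data are bounded on closed sub-slabs.** If `(u,p)` is
classical on `[0,T)`, Leray–Hopf on `[0,T]` from `u 0`, and `u 0` decays rapidly, then for every `T' < T` the
velocity is bounded on `[0,T'] × ℝ³`.  Proof: on the horizon `T'' = (T'+T)/2 < T` the solution trivially «extends
past `T''`» (by itself), so `FastClassSqueeze.bounded_of_hasSmoothExtensionPast` (Tao 2013 persistence of
regularity + energy inequality) bounds it on `[0,T'')`, which contains `[0,T']`.  This discharges the hypothesis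
«`∀ T' < T, ∃ M, ∀ t ∈ [0,T'], ∀ x, ‖u t x‖ ≤ M`» of the standing class of ⟨19059⟩/⟨19060⟩ from the other ones.
[cite: Tao2011, Cor. 11.1] -/
theorem exists_bound_subslab {ν T : ℝ} (hν : 0 < ν) (hT : 0 < T) {u : ℝ → E3 → E3} {p : ℝ → E3 → ℝ}
    (hcl : IsClassicalNSSolutionOn (Ico 0 T) ν 0 u p) (hLH : IsLerayHopfOn T ν 0 (u 0) u)
    (hdec : HasRapidSpatialDecay (u 0)) :
    ∀ T' < T, ∃ B : ℝ, ∀ t ∈ Icc 0 T', ∀ x, ‖u t x‖ ≤ B := by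
  intro T' hT'
  set T'' : ℝ := (max T' 0 + T) / 2 with hT''
  have hmax : max T' 0 < T := max_lt hT' hT
  have hT''pos : 0 < T'' := by
    rw [hT'']; linarith [le_max_right T' 0]
  have hT'T'' : T' < T'' := by
    rw [hT'']; linarith [le_max_left T' 0]
  have hT''T : T'' < T := by
    rw [hT'']; linarith
  have hcl'' : IsClassicalNSSolutionOn (Ico 0 T'') ν 0 u p :=
    hcl.mono (Ico_subset_Ico_right hT''T.le) (uniqueDiffOn_Ico 0 T'')
  have hLH'' : IsLerayHopfOn T'' ν 0 (u 0) u := hLH.of_le hT''T.le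
  have hext : HasSmoothExtensionPast ν 0 u T'' := ⟨T, hT''T, u, p, hcl, fun _ _ => rfl⟩
  obtain ⟨B, hB⟩ :=
    FastClassSqueeze.bounded_of_hasSmoothExtensionPast ν T'' hν hT''pos u p hcl'' hLH'' hdec hext
  exact ⟨B, fun t ht x => hB t ⟨ht.1, lt_of_le_of_lt ht.2 hT'T''⟩ x⟩

/-- **Zhang 2026 Thm 1.1 BY NAME, modulo the one-dimensional barrier.** If for every `c, T > 0` there is a
time-dependent half-line barrier `w(r,t)` on `(0,2) × (0,T)` for the envelope `E(r,t) = c/√(T−t)` — jointly `C²`,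
continuous on `[0,2] × [0,T)`, `w(0,t) = 0`, nondecreasing in `r`, `w ≤ C r^α` on `[0,1]` uniformly in `t` (`α > 0`),
`w(1,t) ≥ 1`, `w(r,0) ≥ min(r,1)²`, `w_rr − w_r/r + (c/√(T−t)) w_r ≤ w_t` — then the tree's named fact
`Zhang2026_partialTypeI_regularity` holds.  Proof: sub-slab bounds (`exists_bound_subslab`), the criterion
`hasSmoothExtensionPast_of_timeDependentBarrier` (gate on the unit tube read off Zhang's global gate), and
`FastClassSqueeze.bounded_of_hasSmoothExtensionPast` for the boundedness conclusion.
[cite: Zhang2026PartialTypeI, Thm. 1.1 (arXiv:2604.07785 §1) with §3 Step 1] -/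
theorem zhang2026_partialTypeI_of_barrier
    (hB : ∀ c T : ℝ, 0 < c → 0 < T → ∃ (α C : ℝ) (w : ℝ → ℝ → ℝ), 0 < α ∧
      ContDiffOn ℝ 2 (fun q : ℝ × ℝ => w q.1 q.2) (Ioo 0 2 ×ˢ Ioo 0 T) ∧
      ContinuousOn (fun q : ℝ × ℝ => w q.1 q.2) (Icc 0 2 ×ˢ Ico 0 T) ∧
      (∀ t ∈ Ico 0 T, w 0 t = 0 ∧ MonotoneOn (fun r => w r t) (Icc 0 2) ∧
        (∀ r ∈ Icc (0 : ℝ) 1, w r t ≤ C * r ^ α) ∧ 1 ≤ w 1 t) ∧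
      (∀ r ∈ Icc (0 : ℝ) 2, min r 1 ^ 2 ≤ w r 0) ∧
      (∀ r ∈ Ioo (0 : ℝ) 2, ∀ t ∈ Ioo 0 T,
        iteratedDeriv 2 (fun ρ => w ρ t) r - r⁻¹ * deriv (fun ρ => w ρ t) r
            + c / Real.sqrt (T - t) * deriv (fun ρ => w ρ t) r ≤ deriv (fun s => w r s) t)) :
    Zhang2026_partialTypeI_regularity := by
  intro c T hc hT u p hcl hLH hdec hax _hswirl hgate
  obtain ⟨α, C, w, hα, hC2j, hC0j, hsl, hdat0, hpde⟩ := hB c T hc hT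
  have hbd := exists_bound_subslab one_pos hT hcl hLH hdec
  have hext : HasSmoothExtensionPast 1 0 u T :=
    hasSmoothExtensionPast_of_timeDependentBarrier (E := fun _ t => c / Real.sqrt (T - t)) hT hα hC2j hC0j
      hsl hdat0 hpde hcl hLH hdec hbd hax (fun t ht x _ _ => hgate t ht x)
  exact FastClassSqueeze.bounded_of_hasSmoothExtensionPast 1 T one_pos hT u p hcl hLH hdec hext

end Summit.NavierStokesRegularity.NavierStokesRegularity.Theorems.RadialInflowComparisonT

end
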